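import Summits.HodgeConjecture.HodgeConjecture.Cruxes.BlochSeedDiscOne.MonadAlphabet
import Mathlib.LinearAlgebra.Matrix.Charpoly.Basic

/-!
# Torus-character designs on the compound frame of `E⁸` — the U2 TORUS TOY (hsemireg-semihom-2 g14)

Bus token (D-0145): `line stmt-HodgeConjecture-18881 Cruxes/BlochSeedDiscOne/Lines/birth.lean 814a6a70c14e831a stub_rung_pad4_seedAt`.
Workfile of crux `BlochSeedDiscOne` (U2 NON-BOX semi-homogeneous letters); evidence ∕ calibration object, NOT a rung.  Nothing here is proved
toward HC ∕ HC_CM ∕ HC_AV ∕ №4 ∕ 26512 ∕ 18881 ∕ H2.  No `instance`, no `notation`, no named fact, no `native_decide`, 0 `sorry`.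

## What this file certifies (kernel)

Answer to the checker's standing flag «STILL NOT COVERED: a positive NON-box toy» (hsemireg-c5c8-1 `SEED-CHECKER-C5C8-c5c8-1-g25.md` §2∕§4,
`SeedCheckerCompound.lean` §25.5: the only non-box monad-side object of record, the Fourier letter, FAILS `XScreen`):

* §1 **LEMMA T (covariance)** — for the phase torus `(ℤ∕4)⁸` acting on slope numerators `M ∈ Herm₈(ℤ[i])` by `(a·M)_{jk} = i^{a_j−a_k} M_{jk}`,
  every minor transforms by a character: `det (a·M)[I;J] = u_a(I)·conj u_a(J)·det M[I;J]` (`minor_torusAct`).  Hence the class function of a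
  TORUS DESIGN `Σ_t f(t)·[⟨a_t·M, r⟩]` on `MonadAlphabet.nonboxAlphabet` FACTORISES word by word as `bracket × (r · minor M)` (`designCh_eq`),
  and `XScreen` reduces to a statement about the character bracket alone (`xscreen_designCh`): a design is clean as soon as the bracket kills
  every off-diagonal non-Weil word with non-zero base minor and has constant diagonal.
* §3 **THE TOY** — base letter the chain Gram `x₀ = W₀W₀*` of the unit chain frame (`μ(x₀) = det x₀[I₀;J₀] = 1`), cell letter `4·1 − x₀`
  (numerator of `L_{4I − x₀}`, apex convention `h = 4` of semihom-2 g6 §1), index group `Ḡ ≅ (ℤ∕4)³` with basis `g1 g2 g3` (= `S⊥ ∕ scalars` for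
  the light-alias-free annihilator `S = S256L` found by machine, `|S| = 256`), sign `f(k) = (−1)^{k₂+k₃} = χ_W(a(k))`: the signed 64-letter design
  `toyCh` has bracket `F(s₁,s₂,s₃)` depending only on the three signatures `sg gᵢ I J = Σ_I gᵢ + 3 Σ_J gᵢ (mod 4)` (`bracket_toy_eq`), `F` vanishes off the
  Weil signature `(0,2,2)` (`F_vanish`, 63 cases) and equals `64` on it (`F_weil`); the ALIAS TABLE (`alias_table`, kernel enumeration of all `2¹⁶` word
  pairs) says the Weil signature is hit only by diagonal words, the two Weil words, and words whose base minor vanishes (six heavy complementary words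
  `0136∣2457, 0145∣2367, 0235∣1467` + transposes).  Consequences: `toy_xscreen : XScreen toyCh`, `toy_mu : toyCh eXWord = 64`, `toy_mubar`, `toy_rank :
  toyCh oneXWord = 0` — the signed part has the PURE WEIL CLASS `64·(E + Ē)`.
* §4 apex letters `⟨c·1, r⟩` are `XScreen`-neutral (`minor_smul_one`, structural: `det (c·1)[I;J] = [I=J]·c^{|I|}`).
* §5 **THE HONEST PRESENTATION** `toyPres : Presentation nonboxAlphabet` (UP reading `⊕_P → ⊕_N → 𝓔 → 0`): `N` = the 32 letters `L_{4I − a(k)·x₀}` with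
  `χ_W = +1` ⊔ apex `L_{4I}^{33}`, `P` = the 32 letters with `χ_W = −1`; the 64 letters are pairwise distinct (`letterOf_injective`), Hermitian
  (`toyPres_allHerm`), none is box (`letterOf_not_box`); `toyPres_clean : XScreen toyPres.wch`, `toyPres_mu : toyPres.wch eXWord = 64`, `toyPres_rank = 33`,
  `toyPres_counts : |N| = 33 ∧ |P| = 32 ∧ count = 33`.  `toy_jsonSide` bundles EXACTLY the three design-side hypotheses `hherm ∕ hclean ∕ hμ` of
  `SeedChecker.hasHyperbolicBFSheafSeedOn_of_nonboxPresentation` (`AllHermPres toyPres` is `toyPres_allHerm` verbatim) — the first non-box design of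
  record that passes the json side of the compound door; `toy_monad_jsonSide` is the same for the three-term reading `MonadDesign.ofCokernel toyPres`
  (`AllHermMonad ∕ CleanX ∕ muX ≠ 0` of `hasHyperbolicBFSheafSeedOn_of_nonboxMonadDesign`, plus `rankX = 33`, `muBarX = 64`).  The object side
  (`XRealisesTensorAtScale`, semiregularity) is untouched: that is U1 ∕ checker business — and §7 shows no object can carry THIS design as a seed.
* §6 **UP-Hall (KI) holds** (`toyPres_hallUp : (MonadDesign.ofCokernel toyPres).HallI`): `apex − letter = a·x₀` (the torus fixes scalars), principal minors
  are torus-invariant (`|u_a(I)|² = 1`), and `x₀ ⪰ 0` in the live rule (`chainLetter_pmn`: minors of size `≤ 4` by kernel, size `≥ 5` vanish for every Gram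
  `W W*`, `W ∈ M_{8×4}` — `minor_gram_eq_zero`, zero-padding), so the apex (multiplicity `33 ≥ 32 = |P|`) is live above every letter.
* §7 **NO-BARE fails** (`toy_N_letters_bare`): distinct letters are incomparable in the live rule (`letters_incomparable`: a super-diagonal `2×2` principal
  minor of `a′·c − a·c` is `−|δ|² < 0`, kernel), so no `P`-cell is live below any `N`-letter: all `32` `N`-letters are bare summands (`Σ ≠ ∅`).
* §8 (v1.1) **VARIANT B** (`toyPresB`: top apex `×40`, plus the BOTTOM APEX `P`-cell `⟨(−4)·1, 1⟩ ×8`): `8·1 − x₀ ≻ 0` (`eightSub_pd`, Weinstein–Aronszajn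
  reduction to `256` kernel-checked `4×4` determinants via Mathlib `Matrix.charpoly_mul_comm'`), so the bottom apex is live below every `N`-cell and
  `variantB_designSide` certifies ALL design-side screens at once (Hermitian, `XScreen`, `μ = 64`, rank `32`, `(KI)`, NO-BARE PROPER).  HONEST SCOPE:
  rank `32 ≥ dim E_i⁸ = 8` is the stable range (generic maps are fibrewise injective by the Porteous count; every effective K-class of rank `≥ dim X` is
  a bundle), so this is NO evidence toward a seed — it isolates the object side (`hR`, local freeness, `IsISemiregular`) as the entire content, and
  records that NO-BARE verdicts are relative to alphabets without bottom apexes.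

## What it is NOT

NOT a seed: `toyPres` is certified NO-BARE-dead (§7, as every two-copy UP design on line-bundle letters at one height, semihom-2 g2 (A)); `rank = 33`,
`μ = μ̄ = 64`, `|μ|∕rank = 64∕33`; `toyPresB` (§8) passes every design-side screen but sits in the stable range where that is automatic, and nothing
object-side is claimed for either.  It is an ADDRESS ∕ CALIBRATION object: a two-sided control for the c5c8 compound checker on genuinely
non-box cells (json side + (KI) pass, NO-BARE fails, all in the kernel), and the worked instance of Lemma T (torus-character designs), which is the
structural content.  Minimality: `64` letters is optimal among subgroup-character designs on this base letter (exhaustive elementary-2-subgroup bound,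
machine; memo §3); the general signed-design minimum over the full torus orbit is OPEN (memo §7 PREREG).
-/

set_option linter.dupNamespace false

namespace Summit.HodgeConjecture.HodgeConjecture.Cruxes.BlochSeedDiscOne.CompoundTorusDesign

open Finset BigOperators Matrix
open Summit.HodgeConjecture.HodgeConjecture.Cruxes.BlochSeedDiscOne.MonadAlphabet

/-- the Gaussian unit `i`. -/
def iU : GaussianInt := ⟨0, 1⟩

theorem star_iU_mul_iU : star iU * iU = 1 := by decide

theorem star_iU_pow_mul (n : ℕ) : star (iU ^ n) * iU ^ n = 1 := by
  rw [star_pow, ← mul_pow, star_iU_mul_iU, one_pow]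

/-- the PHASE-TORUS ACTION of `a ∈ (ℤ∕4)^8` (exponents as naturals, read through `i^4 = 1`) on a slope numerator:
`(a·M)_{jk} = i^{a_j} · M_{jk} · conj(i^{a_k})` — conjugation by the diagonal unitary `diag(i^{a_j})`. -/
def torusAct (a : Fin 8 → ℕ) (M : Matrix (Fin 8) (Fin 8) GaussianInt) : Matrix (Fin 8) (Fin 8) GaussianInt :=
  Matrix.of fun j k => iU ^ a j * M j k * star (iU ^ a k)

/-- the phase `u_a(I) = Π_{j ∈ I} i^{a_j}` of a coordinate set. -/
def phase (a : Fin 8 → ℕ) (I : Finset (Fin 8)) : GaussianInt := ∏ j ∈ I, iU ^ a j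

theorem enum8_nodup (I : Finset (Fin 8)) : (enum8 I).Nodup := (List.nodup_finRange 8).filter _

theorem enum8_toFinset (I : Finset (Fin 8)) : (enum8 I).toFinset = I := by
  ext j; simp [enum8]

theorem prod_enum8_get (I : Finset (Fin 8)) (g : Fin 8 → GaussianInt) :
    ∏ i : Fin (enum8 I).length, g ((enum8 I).get i) = ∏ j ∈ I, g j := by
  rw [← enum8_toFinset I, List.prod_toFinset _ (enum8_nodup I), enum8_toFinset]
  simp [Fin.prod_univ_fun_getElem]

/-- **COVARIANCE OF MINORS under the phase torus**: `det (a·M)[I;J] = u_a(I) · conj u_a(J) · det M[I;J]`. -/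
theorem minor_torusAct (a : Fin 8 → ℕ) (M : Matrix (Fin 8) (Fin 8) GaussianInt) (I J : Finset (Fin 8)) :
    minor (torusAct a M) I J = phase a I * star (phase a J) * minor M I J := by
  unfold minor
  by_cases h : (enum8 J).length = (enum8 I).length
  · rw [dif_pos h, dif_pos h]
    set rI : Fin (enum8 I).length → Fin 8 := fun i => (enum8 I).get i with hrI
    set cJ : Fin (enum8 I).length → Fin 8 := fun j => (enum8 J).get (Fin.cast h.symm j) with hcJ
    have key : (torusAct a M).submatrix rI cJ =
        Matrix.diagonal (fun i => iU ^ a (rI i)) * M.submatrix rI cJ * Matrix.diagonal (fun j => star (iU ^ a (cJ j))) := by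
      refine Matrix.ext fun i j => ?_
      simp [torusAct, Matrix.submatrix_apply, Matrix.mul_diagonal, Matrix.diagonal_mul, Matrix.of_apply]
    rw [key, Matrix.det_mul, Matrix.det_mul, Matrix.det_diagonal, Matrix.det_diagonal]
    have hI : ∏ i : Fin (enum8 I).length, iU ^ a (rI i) = phase a I := by
      simpa [hrI, phase] using prod_enum8_get I (fun j => iU ^ a j)
    have hJ : ∏ j : Fin (enum8 I).length, star (iU ^ a (cJ j)) = star (phase a J) := by
      have e : ∏ j : Fin (enum8 I).length, star (iU ^ a (cJ j)) =
          ∏ j : Fin (enum8 J).length, star (iU ^ a ((enum8 J).get j)) := by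
        simpa [hcJ] using
          (Fintype.prod_equiv (finCongr h.symm) (fun j => star (iU ^ a (cJ j)))
            (fun j => star (iU ^ a ((enum8 J).get j))) (fun j => rfl))
      rw [e, phase, star_prod]
      exact prod_enum8_get J (fun j => star (iU ^ a j))
    rw [hI, hJ]; ring
  · rw [dif_neg h, dif_neg h]; ring


/-! ## §2 Signed torus designs: class function = bracket × minor -/

/-- the CLASS FUNCTION of the signed torus design `Σ_{t ∈ T} f(t) · [letter (a_t·M, rank weight r)]` on the non-box alphabet:
`(I;J) ↦ Σ_t f(t) · r · det (a_t·M)[I;J]` (= `MonadDesign.wch` of the design with these letters and multiplicities, cf. `designCh_eq_sum_ch`). -/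
def designCh {ι : Type} (T : Finset ι) (a : ι → Fin 8 → ℕ) (f : ι → ℤ) (r : ℕ) (M : Matrix (Fin 8) (Fin 8) GaussianInt) :
    XWord → GaussianInt :=
  fun w => ∑ t ∈ T, (f t : GaussianInt) * compoundCh r (torusAct (a t) M) w

/-- the design class function is literally the signed sum of the alphabet's `ch` of the letters `⟨a_t·M, r⟩`. -/
theorem designCh_eq_sum_ch {ι : Type} (T : Finset ι) (a : ι → Fin 8 → ℕ) (f : ι → ℤ) (r : ℕ+)
    (M : Matrix (Fin 8) (Fin 8) GaussianInt) (w : XWord) :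
    designCh T a f r M w = ∑ t ∈ T, (f t : GaussianInt) * nonboxAlphabet.ch ⟨torusAct (a t) M, r⟩ w := rfl

/-- the CHARACTER BRACKET `B(I;J) = Σ_t f(t) · u_{a_t}(I) · conj u_{a_t}(J)`. -/
def bracket {ι : Type} (T : Finset ι) (a : ι → Fin 8 → ℕ) (f : ι → ℤ) (I J : Finset (Fin 8)) : GaussianInt :=
  ∑ t ∈ T, (f t : GaussianInt) * (phase (a t) I * star (phase (a t) J))

/-- **FACTORISATION**: the class function of a torus design is `bracket × (r · minor of the base letter)`, word by word. -/
theorem designCh_eq {ι : Type} (T : Finset ι) (a : ι → Fin 8 → ℕ) (f : ι → ℤ) (r : ℕ) (M : Matrix (Fin 8) (Fin 8) GaussianInt)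
    (I J : Finset (Fin 8)) :
    designCh T a f r M (I, J) = bracket T a f I J * ((r : GaussianInt) * minor M I J) := by
  unfold designCh bracket compoundCh
  rw [Finset.sum_mul]
  refine Finset.sum_congr rfl fun t _ => ?_
  dsimp only
  rw [minor_torusAct]; ring

theorem phase_mul_star_self (a : Fin 8 → ℕ) (I : Finset (Fin 8)) : phase a I * star (phase a I) = 1 := by
  unfold phase
  rw [star_prod, ← Finset.prod_mul_distrib]
  exact Finset.prod_eq_one fun j _ => by rw [mul_comm]; exact star_iU_pow_mul _

/-- on the diagonal the bracket is the plain coefficient sum `Σ_t f(t)`. -/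
theorem bracket_diag {ι : Type} (T : Finset ι) (a : ι → Fin 8 → ℕ) (f : ι → ℤ) (I : Finset (Fin 8)) :
    bracket T a f I I = ∑ t ∈ T, (f t : GaussianInt) := by
  unfold bracket
  exact Finset.sum_congr rfl fun t _ => by rw [phase_mul_star_self, mul_one]

/-- **LEMMA T (class screen of a torus design)**: if every off-diagonal non-Weil word has vanishing bracket OR vanishing base minor, and the
coefficients sum to zero, the design passes `XScreen` (all off-diagonal non-Weil entries vanish; every diagonal entry is `0`). -/
theorem xscreen_designCh {ι : Type} (T : Finset ι) (a : ι → Fin 8 → ℕ) (f : ι → ℤ) (r : ℕ) (M : Matrix (Fin 8) (Fin 8) GaussianInt)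
    (hoff : ∀ I J : Finset (Fin 8), I ≠ J → (I, J) ≠ (I0, J0) → (I, J) ≠ (J0, I0) → bracket T a f I J = 0 ∨ minor M I J = 0)
    (hsum : ∑ t ∈ T, (f t : GaussianInt) = 0) : XScreen (designCh T a f r M) := by
  refine ⟨fun I J hIJ hE hEbar => ?_, fun I I' _ => ?_⟩
  · rw [designCh_eq]
    rcases hoff I J hIJ hE hEbar with h | h <;> simp [h]
  · rw [designCh_eq, designCh_eq, bracket_diag, bracket_diag, hsum]; simp

/-- the Weil coefficient of a torus design: `μ = B(I₀;J₀) · r · μ(M)`. -/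
theorem designCh_eXWord {ι : Type} (T : Finset ι) (a : ι → Fin 8 → ℕ) (f : ι → ℤ) (r : ℕ) (M : Matrix (Fin 8) (Fin 8) GaussianInt) :
    designCh T a f r M eXWord = bracket T a f I0 J0 * ((r : GaussianInt) * minor M I0 J0) := designCh_eq T a f r M I0 J0

/-- the rank coefficient of a torus design: `(∅;∅) ↦ r · Σ_t f(t)`. -/
theorem designCh_oneXWord {ι : Type} (T : Finset ι) (a : ι → Fin 8 → ℕ) (f : ι → ℤ) (r : ℕ) (M : Matrix (Fin 8) (Fin 8) GaussianInt) :
    designCh T a f r M oneXWord = (∑ t ∈ T, (f t : GaussianInt)) * ((r : GaussianInt) * minor M ∅ ∅) := by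
  rw [← bracket_diag T a f ∅]; exact designCh_eq T a f r M ∅ ∅

/-! ## §3 The 64-letter toy: base letter = the (U2) chain letter `x₀ = W₀W₀*`, group `Ḡ ≅ (ℤ∕4)³`, coefficients `χ_W = ±1` -/

/-- the (U2) CHAIN LETTER at phase `t = 0`: `x₀ = W₀ W₀*` for the chain frame `v₁ = e₀−e₁+e₂−e₃`, `v₂ = e₂−e₃+e₄−e₅`, `v₃ = e₄−e₅+e₆−e₇`,
`v₄ = e₆−e₇` (semihom-2 g1∕g9 frame of record); Hermitian, psd, rank 4, NOT box, Weil minor `μ(x₀) = 1`. -/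
def chainLetter : Matrix (Fin 8) (Fin 8) GaussianInt :=
  !![1, -1, 1, -1, 0, 0, 0, 0;
     -1, 1, -1, 1, 0, 0, 0, 0;
     1, -1, 2, -2, 1, -1, 0, 0;
     -1, 1, -2, 2, -1, 1, 0, 0;
     0, 0, 1, -1, 2, -2, 1, -1;
     0, 0, -1, 1, -2, 2, -1, 1;
     0, 0, 0, 0, 1, -1, 2, -2;
     0, 0, 0, 0, -1, 1, -2, 2]

theorem chainLetter_probe : (⟨chainLetter, 1⟩ : NonboxLetter).IsHerm ∧ ¬ (⟨chainLetter, 1⟩ : NonboxLetter).IsBox ∧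
    minor chainLetter I0 J0 = 1 ∧ minor chainLetter J0 I0 = 1 ∧ minor chainLetter ∅ ∅ = 1 := by
  decide +kernel

/-- the CELL LETTER of record `4·1 − x₀`: slope numerator of the line bundle `L_{4I − x₀}` (semihom-2 g6 §1 apex convention `h = 4`: `N`-letters
`L_{4I − x}`, apex `L_{4I}`).  The torus acts through `x₀` only: `a·(4·1 − x₀) = 4·1 − a·x₀` (`torusAct_cellM`). -/
def cellM : Matrix (Fin 8) (Fin 8) GaussianInt :=
  !![3, 1, -1, 1, 0, 0, 0, 0;
     1, 3, 1, -1, 0, 0, 0, 0;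
     -1, 1, 2, 2, -1, 1, 0, 0;
     1, -1, 2, 2, 1, -1, 0, 0;
     0, 0, -1, 1, 2, 2, -1, 1;
     0, 0, 1, -1, 2, 2, 1, -1;
     0, 0, 0, 0, -1, 1, 2, 2;
     0, 0, 0, 0, 1, -1, 2, 2]

theorem cellM_eq : cellM = 4 • (1 : Matrix (Fin 8) (Fin 8) GaussianInt) - chainLetter := by
  decide +kernel

/-- kernel probe of the cell letter: Hermitian, not box, Weil minor `det(−x₀[I₀;J₀]) = μ(x₀) = 1`, `μ̄ = 1`, rank coefficient `1`, corner entry `3`. -/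
theorem cellM_probe : (⟨cellM, 1⟩ : NonboxLetter).IsHerm ∧ ¬ (⟨cellM, 1⟩ : NonboxLetter).IsBox ∧
    minor cellM I0 J0 = 1 ∧ minor cellM J0 I0 = 1 ∧ minor cellM ∅ ∅ = 1 ∧ cellM 0 0 = 3 := by
  decide +kernel

/-- generators of `Ḡ ≅ (ℤ∕4)³ ≤ (ℤ∕4)⁸ ∕ scalars` (`Ḡ^⊥ ∩ 𝟙^⊥ = S`, the light-alias-free admissible subgroup `S256L` of the memo, `|S| = 256`). -/
def g1 : Fin 8 → ℕ := ![0, 0, 0, 1, 1, 1, 3, 2]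
/-- second generator of `Ḡ`. -/
def g2 : Fin 8 → ℕ := ![0, 0, 1, 0, 1, 0, 3, 3]
/-- third generator of `Ḡ`. -/
def g3 : Fin 8 → ℕ := ![0, 1, 0, 0, 1, 1, 0, 1]

/-- the index set of the toy: `k = (k₁,k₂,k₃) ∈ (ℤ∕4)³`. -/
abbrev K3 : Type := Fin 4 × Fin 4 × Fin 4

/-- the phase vector of letter `k`: `a(k) = k₁g₁ + k₂g₂ + k₃g₃` (exponents as naturals). -/
def aOf (k : K3) : Fin 8 → ℕ := fun j => k.1.val * g1 j + k.2.1.val * g2 j + k.2.2.val * g3 j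

/-- the coefficient of letter `k`: `f(k) = χ_W(a(k)) = (−1)^{k₂+k₃}` (`χ_W(g₁) = 1`, `χ_W(g₂) = χ_W(g₃) = −1`). -/
def fOf (k : K3) : ℤ := if (k.2.1.val + k.2.2.val) % 2 = 0 then 1 else -1

/-- **THE TOY** (signed part): class function of the signed 64-letter design `Σ_{k ∈ (ℤ∕4)³} (−1)^{k₂+k₃} · [⟨a(k)·(4·1 − x₀), 1⟩]`
(32 letters `+1` = `N`-side, 32 letters `−1` = `P`-side; the apex `⟨4·1, 1⟩^33` is added in §5). -/
def toyCh : XWord → GaussianInt := designCh Finset.univ aOf fOf 1 cellM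

/-- the word signature against a generator: `σ_g(I;J) = Σ_{j∈I} g_j + 3·Σ_{j∈J} g_j` (≡ `⟨g, 1_I − 1_J⟩ mod 4`). -/
def sg (g : Fin 8 → ℕ) (I J : Finset (Fin 8)) : ℕ := ∑ j ∈ I, g j + 3 * ∑ j ∈ J, g j

/-- the bracket as a function of the three signatures: `F(s₁,s₂,s₃) = Σ_k f(k) · i^{k₁s₁+k₂s₂+k₃s₃}`. -/
def F (s1 s2 s3 : ℕ) : GaussianInt := ∑ k : K3, (fOf k : GaussianInt) * iU ^ (k.1.val * s1 + k.2.1.val * s2 + k.2.2.val * s3)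

theorem star_iU : star iU = iU ^ 3 := by decide

theorem iU_pow_four : iU ^ 4 = 1 := by decide

theorem iU_pow_mod (n : ℕ) : iU ^ n = iU ^ (n % 4) := by
  conv_lhs => rw [← Nat.div_add_mod n 4, pow_add, pow_mul, iU_pow_four, one_pow, one_mul]

theorem phase_eq_pow_sum (a : Fin 8 → ℕ) (I : Finset (Fin 8)) : phase a I = iU ^ ∑ j ∈ I, a j :=
  Finset.prod_pow_eq_pow_sum I a iU

theorem sum_aOf (k : K3) (I : Finset (Fin 8)) :
    ∑ j ∈ I, aOf k j = k.1.val * ∑ j ∈ I, g1 j + k.2.1.val * ∑ j ∈ I, g2 j + k.2.2.val * ∑ j ∈ I, g3 j := by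
  simp only [aOf, Finset.sum_add_distrib, Finset.mul_sum]

/-- **the bracket of the toy is `F` of the three signatures** (structural). -/
theorem bracket_toy_eq (I J : Finset (Fin 8)) :
    bracket Finset.univ aOf fOf I J = F (sg g1 I J) (sg g2 I J) (sg g3 I J) := by
  unfold bracket F
  refine Finset.sum_congr rfl fun k _ => ?_
  rw [phase_eq_pow_sum, phase_eq_pow_sum, star_pow, star_iU, ← pow_mul, ← pow_add, sum_aOf, sum_aOf]
  congr 2
  unfold sg; ring

theorem F_mod (s1 s2 s3 : ℕ) : F s1 s2 s3 = F (s1 % 4) (s2 % 4) (s3 % 4) := by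
  unfold F
  refine Finset.sum_congr rfl fun k _ => ?_
  have h : (k.1.val * s1 + k.2.1.val * s2 + k.2.2.val * s3) % 4 =
      (k.1.val * (s1 % 4) + k.2.1.val * (s2 % 4) + k.2.2.val * (s3 % 4)) % 4 :=
    Nat.ModEq.add (Nat.ModEq.add (Nat.ModEq.mul_left _ (Nat.mod_modEq s1 4).symm)
      (Nat.ModEq.mul_left _ (Nat.mod_modEq s2 4).symm)) (Nat.ModEq.mul_left _ (Nat.mod_modEq s3 4).symm)
  rw [iU_pow_mod, h, ← iU_pow_mod]

/-- character orthogonality on `Ḡ ≅ (ℤ∕4)³`, by enumeration: `F` vanishes at every residue triple except `(0,2,2)` (the Weil signature). -/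
theorem F_vanish : ∀ r : K3, r ≠ (0, 2, 2) → F r.1.val r.2.1.val r.2.2.val = 0 := by
  decide +kernel

theorem F_weil : F 0 2 2 = 64 := by
  decide +kernel

/-- **ALIASING TABLE** (kernel enumeration of all `2¹⁶` word pairs): a pair with the Weil signature `(0,2,2)` is diagonal, a Weil word, or has
vanishing base minor (the six complementary words `0136∣2457, 0145∣2367, 0235∣1467` and transposes, `det (4·1−x₀)[I;I^c] = det x₀[I;I^c] = 0`). -/
theorem alias_table : ∀ I J : Finset (Fin 8), (sg g1 I J % 4 = 0 ∧ sg g2 I J % 4 = 2 ∧ sg g3 I J % 4 = 2) →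
    (I = J ∨ (I, J) = (I0, J0) ∨ (I, J) = (J0, I0) ∨ minor cellM I J = 0) := by
  decide +kernel

theorem toy_hoff (I J : Finset (Fin 8)) (hIJ : I ≠ J) (hE : (I, J) ≠ (I0, J0)) (hEbar : (I, J) ≠ (J0, I0)) :
    bracket Finset.univ aOf fOf I J = 0 ∨ minor cellM I J = 0 := by
  by_cases hs : sg g1 I J % 4 = 0 ∧ sg g2 I J % 4 = 2 ∧ sg g3 I J % 4 = 2
  · right
    rcases alias_table I J hs with h | h | h | h
    exacts [absurd h hIJ, absurd h hE, absurd h hEbar, h]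
  · left
    rw [bracket_toy_eq, F_mod]
    have h4 : ∀ n : ℕ, n % 4 < 4 := fun n => Nat.mod_lt n (by norm_num)
    have := F_vanish (⟨sg g1 I J % 4, h4 _⟩, ⟨sg g2 I J % 4, h4 _⟩, ⟨sg g3 I J % 4, h4 _⟩) (by
      intro hr
      apply hs
      simp only [Prod.mk.injEq, Fin.ext_iff] at hr
      exact hr)
    simpa using this

theorem toy_hsum : ∑ k : K3, (fOf k : GaussianInt) = 0 := by
  decide +kernel

/-- **THEOREM (64-letter non-box torus toy passes the class screen).** -/
theorem toy_xscreen : XScreen toyCh :=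
  xscreen_designCh Finset.univ aOf fOf 1 cellM toy_hoff (by simpa using toy_hsum)

/-- **… with Weil charge `μ = 64`** (and `μ̄ = 64`: the class is the pure Weil class `64·(E + Ē)`). -/
theorem toy_mu : toyCh eXWord = 64 := by
  rw [toyCh, designCh_eXWord, bracket_toy_eq, cellM_probe.2.2.1]
  have hs : (sg g1 I0 J0, sg g2 I0 J0, sg g3 I0 J0) = (16, 14, 10) := by decide +kernel
  simp only [Prod.mk.injEq] at hs
  rw [hs.1, hs.2.1, hs.2.2, F_mod]; norm_num [F_weil]

/-- rank coefficient `0`: the signed design is traceless (`32` letters `+1`, `32` letters `−1`); the UP reading adds `m ≥ 33` apex letters `⟨h·1, 1⟩`. -/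
theorem toy_rank : toyCh oneXWord = 0 := by
  rw [toyCh, designCh_oneXWord]; simp [toy_hsum]

/-- `μ̄ = 64` as well: the class of the signed design is the PURE WEIL CLASS `64·(E + Ē)`. -/
theorem toy_mubar : toyCh ebarXWord = 64 := by
  rw [toyCh, ebarXWord, designCh_eq, bracket_toy_eq, cellM_probe.2.2.2.1]
  have hs : (sg g1 J0 I0, sg g2 J0 I0, sg g3 J0 I0) = (16, 18, 6) := by decide +kernel
  simp only [Prod.mk.injEq] at hs
  rw [hs.1, hs.2.1, hs.2.2, F_mod]; norm_num [F_weil]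

/-! ## §4 Apex letters `⟨c·1, r⟩` are `XScreen`-neutral (structural) -/

theorem length_enum8 (I : Finset (Fin 8)) : (enum8 I).length = I.card := by
  have h := List.toFinset_card_of_nodup (enum8_nodup I)
  rw [enum8_toFinset] at h
  exact h.symm

theorem mem_enum8 {I : Finset (Fin 8)} {x : Fin 8} : x ∈ enum8 I ↔ x ∈ I := by
  simp [enum8]

/-- minors of a scalar matrix in the `enum8` indexing: `det (c·1)[I;J] = [I = J] · c^{|I|}`. -/
theorem minor_smul_one (c : GaussianInt) (I J : Finset (Fin 8)) :
    minor (c • (1 : Matrix (Fin 8) (Fin 8) GaussianInt)) I J = if I = J then c ^ I.card else 0 := by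
  unfold minor
  by_cases h : (enum8 J).length = (enum8 I).length
  · rw [dif_pos h]
    by_cases hIJ : I = J
    · subst hIJ
      rw [if_pos rfl]
      have hsub : (c • (1 : Matrix (Fin 8) (Fin 8) GaussianInt)).submatrix (fun i : Fin (enum8 I).length => (enum8 I).get i)
          (fun j => (enum8 I).get (Fin.cast h.symm j)) = c • (1 : Matrix (Fin (enum8 I).length) (Fin (enum8 I).length) GaussianInt) := by
        refine Matrix.ext fun i j => ?_
        have hc : Fin.cast h.symm j = j := Fin.ext rfl
        simp only [Matrix.submatrix_apply, Matrix.smul_apply, Matrix.one_apply, hc, (enum8_nodup I).get_inj_iff]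
      rw [hsub, Matrix.det_smul, Matrix.det_one, mul_one, Fintype.card_fin, length_enum8]
    · rw [if_neg hIJ]
      have hcard : I.card = J.card := by rw [← length_enum8, ← length_enum8, h]
      obtain ⟨x, hxI, hxJ⟩ : ∃ x ∈ I, x ∉ J := by
        by_contra! hcon
        exact hIJ (Finset.eq_of_subset_of_card_le hcon hcard.ge)
      obtain ⟨i, hi⟩ := List.get_of_mem (mem_enum8.2 hxI)
      refine Matrix.det_eq_zero_of_row_eq_zero i fun j => ?_
      have hmem : (enum8 J).get (Fin.cast h.symm j) ∈ J := mem_enum8.1 (List.get_mem (enum8 J) (Fin.cast h.symm j))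
      have hne : (enum8 I).get i ≠ (enum8 J).get (Fin.cast h.symm j) := fun hx => hxJ (hi ▸ hx ▸ hmem)
      simp only [Matrix.submatrix_apply, Matrix.smul_apply, Matrix.one_apply, if_neg hne, smul_zero]
  · rw [dif_neg h]
    have hIJ : I ≠ J := fun hIJ => h (by rw [hIJ])
    rw [if_neg hIJ]

/-- **apex letters pass the class screen**: `ch⟨c·1, r⟩ = r·(1, c·λ, c²·λ², …)` is diagonal and size-homogeneous. -/
theorem xscreen_apex (r : ℕ) (c : GaussianInt) : XScreen (compoundCh r (c • (1 : Matrix (Fin 8) (Fin 8) GaussianInt))) := by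
  refine ⟨fun I J hIJ _ _ => ?_, fun I I' hc => ?_⟩
  · simp [compoundCh, minor_smul_one, hIJ]
  · simp [compoundCh, minor_smul_one, hc]

theorem xscreen_add {T₁ T₂ : XWord → GaussianInt} (h₁ : XScreen T₁) (h₂ : XScreen T₂) : XScreen (T₁ + T₂) :=
  ⟨fun I J hIJ hE hEb => by simp [h₁.1 I J hIJ hE hEb, h₂.1 I J hIJ hE hEb],
    fun I I' hc => by simp [h₁.2 I I' hc, h₂.2 I I' hc]⟩

theorem xscreen_zsmul {T : XWord → GaussianInt} (h : XScreen T) (n : ℤ) : XScreen (n • T) :=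
  ⟨fun I J hIJ hE hEb => by simp [h.1 I J hIJ hE hEb], fun I I' hc => by simp [h.2 I I' hc]⟩

theorem xscreen_neg {T : XWord → GaussianInt} (h : XScreen T) : XScreen (-T) :=
  ⟨fun I J hIJ hE hEb => by simp [h.1 I J hIJ hE hEb], fun I I' hc => by simp [h.2 I I' hc]⟩

/-! ## §5 The toy as an honest two-term presentation over `nonboxAlphabet` (UP reading) and the json side of the compound door -/

/-- the torus action commutes with conjugate transpose. -/
theorem conjTranspose_torusAct (a : Fin 8 → ℕ) (M : Matrix (Fin 8) (Fin 8) GaussianInt) :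
    (torusAct a M).conjTranspose = torusAct a M.conjTranspose := by
  refine Matrix.ext fun j k => ?_
  simp only [torusAct, Matrix.conjTranspose_apply, Matrix.of_apply, star_mul, star_star]
  ring

/-- letters `a·M` of a Hermitian base letter are Hermitian. -/
theorem isHerm_torusAct {M : Matrix (Fin 8) (Fin 8) GaussianInt} (hM : M.conjTranspose = M) (a : Fin 8 → ℕ) (r : ℕ+) :
    (⟨torusAct a M, r⟩ : NonboxLetter).IsHerm := by
  show (torusAct a M).conjTranspose = torusAct a M
  rw [conjTranspose_torusAct, hM]

/-- the `k`-th design letter: `⟨a(k)·(4·1 − x₀), 1⟩` = the line bundle `L_{4I − a(k)·x₀}` read on the compound frame. -/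
def letterOf (k : K3) : NonboxLetter := ⟨torusAct (aOf k) cellM, 1⟩

/-- the APEX letter `⟨4·1, 1⟩` = `L_{4I}`. -/
def apexLetter : NonboxLetter := ⟨(4 : GaussianInt) • (1 : Matrix (Fin 8) (Fin 8) GaussianInt), 1⟩

/-- the 64 letters are pairwise distinct — already on the super-diagonal `(j, j+1)` (the chain's support is connected). [kernel enumeration] -/
theorem letter_superdiag_inj : ∀ k k' : K3,
    (∀ j : Fin 7, torusAct (aOf k) cellM j.castSucc j.succ = torusAct (aOf k') cellM j.castSucc j.succ) → k = k' := by
  decide +kernel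

theorem letterOf_injective : Function.Injective letterOf := fun k k' h =>
  letter_superdiag_inj k k' fun j => by
    have hM : torusAct (aOf k) cellM = torusAct (aOf k') cellM := congrArg NonboxLetter.M h
    rw [hM]

/-- every design letter has corner entry `3` (the torus acts trivially on the diagonal); the apex has corner entry `4`. -/
theorem letterOf_corner (k : K3) : (letterOf k).M 0 0 = 3 := by
  show iU ^ aOf k 0 * cellM 0 0 * star (iU ^ aOf k 0) = 3
  rw [cellM_probe.2.2.2.2.2, mul_comm, ← mul_assoc, star_iU_pow_mul, one_mul]

theorem apexLetter_corner : apexLetter.M 0 0 = 4 := by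
  show ((4 : GaussianInt) • (1 : Matrix (Fin 8) (Fin 8) GaussianInt)) 0 0 = 4
  simp

theorem letterOf_ne_apex (k : K3) : letterOf k ≠ apexLetter := fun h => by
  have h3 := letterOf_corner k
  rw [h, apexLetter_corner] at h3
  exact absurd h3 (by decide)

/-- the letter embedding `(ℤ∕4)³ ↪ NonboxLetter`. -/
def letterEmb : K3 ↪ NonboxLetter := ⟨letterOf, letterOf_injective⟩

/-- indices of the `N`-letters (`f = +1`) and of the `P`-letters (`f = −1`). -/
def Kpos : Finset K3 := Finset.univ.filter fun k => fOf k = 1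
/-- indices of the `P`-letters (`f = −1`). -/
def Kneg : Finset K3 := Finset.univ.filter fun k => fOf k = -1

theorem apex_not_mem : apexLetter ∉ Kpos.map letterEmb := fun h => by
  obtain ⟨k, _, hk⟩ := Finset.mem_map.1 h
  exact letterOf_ne_apex k hk

/-- **THE TOY PRESENTATION (UP reading)** `⊕_P → ⊕_N → 𝓔 → 0` over `nonboxAlphabet`:
`N` = the 32 letters `L_{4I − a(k)·x₀}` with `χ_W(a(k)) = +1` (multiplicity `1`) ⊔ the apex `L_{4I}` (multiplicity `33`);
`P` = the 32 letters with `χ_W(a(k)) = −1` (multiplicity `1`).  Multiplicities are read off the corner entry (`4` ↦ apex). -/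
def toyPres : Presentation nonboxAlphabet where
  N := Finset.cons apexLetter (Kpos.map letterEmb) apex_not_mem
  P := Kneg.map letterEmb
  mN := fun Z => if Z.M 0 0 = 4 then 33 else 1
  mP := fun _ => 1

theorem fOf_cases (k : K3) : fOf k = 1 ∨ fOf k = -1 := by
  unfold fOf; split_ifs <;> simp

theorem compoundCh_apply (r : ℕ) (M : Matrix (Fin 8) (Fin 8) GaussianInt) (I J : Finset (Fin 8)) :
    compoundCh r M (I, J) = (r : GaussianInt) * minor M I J := rfl

@[simp] theorem letterEmb_apply (k : K3) : letterEmb k = letterOf k := rfl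
@[simp] theorem letterOf_rk (k : K3) : (letterOf k).rk = 1 := rfl
@[simp] theorem letterOf_M (k : K3) : (letterOf k).M = torusAct (aOf k) cellM := rfl
@[simp] theorem apexLetter_rk : apexLetter.rk = 1 := rfl
@[simp] theorem apexLetter_M : apexLetter.M = (4 : GaussianInt) • (1 : Matrix (Fin 8) (Fin 8) GaussianInt) := rfl

theorem mN_letter (k : K3) : toyPres.mN (letterOf k) = 1 := by
  show (if (letterOf k).M 0 0 = 4 then (33 : ℤ) else 1) = 1
  rw [letterOf_corner]; decide

theorem mN_apex : toyPres.mN apexLetter = 33 := by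
  show (if apexLetter.M 0 0 = 4 then (33 : ℤ) else 1) = 33
  rw [apexLetter_corner]; simp

theorem toyPres_N : toyPres.N = Finset.cons apexLetter (Kpos.map letterEmb) apex_not_mem := rfl
theorem toyPres_P : toyPres.P = Kneg.map letterEmb := rfl
theorem toyPres_mP (Z : NonboxLetter) : toyPres.mP Z = 1 := rfl

/-- the signed part splits as `Σ_{Kpos} ch − Σ_{Kneg} ch`. -/
theorem toyCh_split (w : XWord) :
    toyCh w = ∑ k ∈ Kpos, nonboxAlphabet.ch (letterOf k) w - ∑ k ∈ Kneg, nonboxAlphabet.ch (letterOf k) w := by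
  simp only [letterOf_rk, letterOf_M, PNat.one_coe]
  show ∑ k ∈ (Finset.univ : Finset K3), (fOf k : GaussianInt) * compoundCh 1 (torusAct (aOf k) cellM) w = _
  rw [← Finset.sum_filter_add_sum_filter_not Finset.univ (fun k => fOf k = 1)]
  have h1 : ∑ k ∈ Finset.univ.filter (fun k => fOf k = 1), (fOf k : GaussianInt) * compoundCh 1 (torusAct (aOf k) cellM) w =
      ∑ k ∈ Kpos, compoundCh 1 (torusAct (aOf k) cellM) w :=
    Finset.sum_congr rfl fun k hk => by rw [(Finset.mem_filter.1 hk).2]; simp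
  have hset : Finset.univ.filter (fun k => ¬ fOf k = 1) = Kneg := by
    ext k
    simp only [Kneg, Finset.mem_filter, Finset.mem_univ, true_and]
    rcases fOf_cases k with h | h
    · simp [h]
    · simp [h]
  have h2 : ∑ k ∈ Finset.univ.filter (fun k => ¬ fOf k = 1), (fOf k : GaussianInt) * compoundCh 1 (torusAct (aOf k) cellM) w =
      -∑ k ∈ Kneg, compoundCh 1 (torusAct (aOf k) cellM) w := by
    rw [hset, ← Finset.sum_neg_distrib]
    exact Finset.sum_congr rfl fun k hk => by rw [(Finset.mem_filter.1 hk).2]; simp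
  rw [h1, h2]; ring

/-- the APEX class `ch⟨4·1, 1⟩`. -/
def apexCh : XWord → GaussianInt := compoundCh 1 ((4 : GaussianInt) • (1 : Matrix (Fin 8) (Fin 8) GaussianInt))

/-- the presentation's class tensor = signed toy part + `33 ×` apex class, word by word. -/
theorem toyPres_wch_apply (w : XWord) : toyPres.wch w = toyCh w + 33 * apexCh w := by
  simp only [Presentation.wch, Pi.sub_apply, Finset.sum_apply, Pi.smul_apply]
  rw [toyPres_N, toyPres_P, Finset.sum_cons, Finset.sum_map, Finset.sum_map, mN_apex]
  simp only [letterEmb_apply, mN_letter, toyPres_mP, one_smul, toyCh_split w, zsmul_eq_mul, letterOf_rk, letterOf_M,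
    apexLetter_rk, apexLetter_M, PNat.one_coe, apexCh]
  push_cast
  ring

theorem toyPres_wch : toyPres.wch = toyCh + fun w => 33 * apexCh w :=
  funext fun w => by rw [toyPres_wch_apply, Pi.add_apply]

theorem xscreen_constMul {T : XWord → GaussianInt} (h : XScreen T) (c : GaussianInt) : XScreen (fun w => c * T w) :=
  ⟨fun I J hIJ hE hEb => by simp [h.1 I J hIJ hE hEb], fun I I' hc => by simp [h.2 I I' hc]⟩

/-- **(A1) ON THE COMPOUND FRAME**: the toy presentation is `XScreen`-clean. -/
theorem toyPres_clean : XScreen toyPres.wch := by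
  rw [toyPres_wch]
  exact xscreen_add toy_xscreen (xscreen_constMul (xscreen_apex 1 4) 33)

/-- **WEIL MINOR `μ = 64`** (`≠ 0`: the hyperbolicity input of the compound door). -/
theorem toyPres_mu : toyPres.wch eXWord = 64 := by
  rw [toyPres_wch_apply, toy_mu, apexCh, eXWord, compoundCh_apply, minor_smul_one, if_neg (show I0 ≠ J0 by decide)]
  simp

theorem toyPres_mubar : toyPres.wch ebarXWord = 64 := by
  rw [toyPres_wch_apply, toy_mubar, apexCh, ebarXWord, compoundCh_apply, minor_smul_one, if_neg (show J0 ≠ I0 by decide)]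
  simp

/-- **rank `33`** (the `(∅;∅)` coefficient: signed part `0`, apex `33`). -/
theorem toyPres_rank : toyPres.wch oneXWord = 33 := by
  rw [toyPres_wch_apply, toy_rank, apexCh, oneXWord, compoundCh_apply, minor_smul_one, if_pos rfl]
  simp

/-- **ALL CELLS HERMITIAN** (the tameness input of the compound door; `SeedChecker.AllHermPres toyPres` is this statement verbatim). -/
theorem toyPres_allHerm : (∀ Z ∈ toyPres.N, NonboxLetter.IsHerm Z) ∧ ∀ Z ∈ toyPres.P, NonboxLetter.IsHerm Z := by
  refine ⟨fun Z hZ => ?_, fun Z hZ => ?_⟩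
  · rw [toyPres_N, Finset.mem_cons] at hZ
    rcases hZ with h | h
    · subst h
      decide +kernel
    · obtain ⟨k, _, rfl⟩ := Finset.mem_map.1 h
      exact isHerm_torusAct cellM_probe.1 _ _
  · rw [toyPres_P] at hZ
    obtain ⟨k, _, rfl⟩ := Finset.mem_map.1 hZ
    exact isHerm_torusAct cellM_probe.1 _ _

/-- **NO CELL IS BOX** (all 64 design letters are genuinely non-box semi-homogeneous line-bundle letters). [kernel enumeration] -/
theorem letterOf_not_box : ∀ k : K3, ¬ (letterOf k).IsBox := by
  decide +kernel

/-- letter and multiplicity counts: `|N| = 33` cells (`32` letters + apex), `|P| = 32`; `Σ m_N − Σ m_P = 65 − 32 = 33 = rank`. -/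
theorem toyPres_counts : toyPres.N.card = 33 ∧ toyPres.P.card = 32 ∧ toyPres.count = 33 := by
  have hp : Kpos.card = 32 := by decide +kernel
  have hn : Kneg.card = 32 := by decide +kernel
  refine ⟨by rw [toyPres_N, Finset.card_cons, Finset.card_map, hp], by rw [toyPres_P, Finset.card_map, hn], ?_⟩
  rw [Presentation.count, toyPres_N, toyPres_P, Finset.sum_cons, Finset.sum_map, Finset.sum_map, mN_apex]
  simp only [letterEmb_apply, mN_letter, toyPres_mP, Finset.sum_const, hp, hn]
  decide

/-- **THE JSON SIDE OF THE COMPOUND DOOR, DISCHARGED FOR A NON-BOX DESIGN**: verbatim the hypotheses `hherm : AllHermPres toyPres`,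
`hclean : XScreen toyPres.wch`, `hμ : toyPres.wch eXWord ≠ 0` of `SeedChecker.hasHyperbolicBFSheafSeedOn_of_nonboxPresentation`
(`SeedCheckerCompound.lean` §25.5).  The object-side hypotheses (`XRealisesTensorAtScale`, `IsISemiregular`) are NOT touched. -/
theorem toy_jsonSide : ((∀ Z ∈ toyPres.N, NonboxLetter.IsHerm Z) ∧ ∀ Z ∈ toyPres.P, NonboxLetter.IsHerm Z) ∧
    XScreen toyPres.wch ∧ toyPres.wch eXWord ≠ 0 :=
  ⟨toyPres_allHerm, toyPres_clean, by rw [toyPres_mu]; decide⟩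

/-- the same for the THREE-TERM reading `MonadDesign.ofCokernel toyPres` (`A = P`, `C = ∅`): verbatim the hypotheses `hherm : AllHermMonad D`,
`hclean : D.CleanX`, `hμ : D.muX ≠ 0` of `SeedChecker.hasHyperbolicBFSheafSeedOn_of_nonboxMonadDesign` ∕ `classCheck_of_nonboxMonadDesign_zeroScheme`;
and `rankX = 33`, `muBarX = 64`. -/
theorem toy_monad_jsonSide :
    ((∀ Z ∈ (MonadDesign.ofCokernel toyPres).A, NonboxLetter.IsHerm Z) ∧ (∀ Z ∈ (MonadDesign.ofCokernel toyPres).N, NonboxLetter.IsHerm Z) ∧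
        ∀ Z ∈ (MonadDesign.ofCokernel toyPres).C, NonboxLetter.IsHerm Z) ∧
      (MonadDesign.ofCokernel toyPres).CleanX ∧ (MonadDesign.ofCokernel toyPres).muX ≠ 0 ∧
      (MonadDesign.ofCokernel toyPres).rankX = 33 ∧ (MonadDesign.ofCokernel toyPres).muBarX = 64 := by
  refine ⟨⟨toyPres_allHerm.2, toyPres_allHerm.1, fun Z hZ => ?_⟩, ?_, ?_, ?_, ?_⟩
  · exact absurd hZ (by simp [MonadDesign.ofCokernel])
  · show XScreen (MonadDesign.ofCokernel toyPres).wch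
    rw [MonadDesign.wch_ofCokernel]; exact toyPres_clean
  · show (MonadDesign.ofCokernel toyPres).wch eXWord ≠ 0
    rw [MonadDesign.wch_ofCokernel, toyPres_mu]; decide
  · show (MonadDesign.ofCokernel toyPres).wch oneXWord = 33
    rw [MonadDesign.wch_ofCokernel, toyPres_rank]
  · show (MonadDesign.ofCokernel toyPres).wch ebarXWord = 64
    rw [MonadDesign.wch_ofCokernel, toyPres_mubar]

/-! ## §6 UP-Hall (KI) for the toy: the apex is live above every letter, with multiplicity `33 ≥ 32 = |P|`

Ingredients: (i) the torus acts trivially on scalar matrices and additively, so `4·1 − a·(4·1 − x₀) = a·x₀`; (ii) `|u_a(I)|² = 1`, so principal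
minors are torus-INVARIANT (`minor (a·M) I I = minor M I I`); (iii) `x₀ = W₀W₀*` has rank `≤ 4`: every minor of size `≥ 5` of a Gram `W W*` with
`W ∈ M_{8×4}` vanishes (zero-padding: `det (A B) = det [A|0]·det [B;0] = 0` for `A ∈ M_{k×4}`, `k ≥ 5`), and the `163` principal minors of size `≤ 4`
are checked by the kernel.  Hence `a·x₀ ⪰ 0` in the alphabet's live rule, `Live (letterOf k) apexLetter`, and (KI) holds. -/

theorem torusAct_sub (a : Fin 8 → ℕ) (M N : Matrix (Fin 8) (Fin 8) GaussianInt) : torusAct a (M - N) = torusAct a M - torusAct a N := by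
  refine Matrix.ext fun j k => ?_
  simp only [torusAct, Matrix.of_apply, Matrix.sub_apply]
  ring

theorem torusAct_smul_one (a : Fin 8 → ℕ) (c : GaussianInt) :
    torusAct a (c • (1 : Matrix (Fin 8) (Fin 8) GaussianInt)) = c • (1 : Matrix (Fin 8) (Fin 8) GaussianInt) := by
  refine Matrix.ext fun j k => ?_
  simp only [torusAct, Matrix.of_apply, Matrix.smul_apply, Matrix.one_apply]
  by_cases hjk : j = k
  · subst hjk
    rw [if_pos rfl, smul_eq_mul, mul_one, mul_comm, ← mul_assoc, star_iU_pow_mul, one_mul]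
  · rw [if_neg hjk, smul_zero, mul_zero, zero_mul]

theorem chainLetter_eq : chainLetter = (4 : GaussianInt) • (1 : Matrix (Fin 8) (Fin 8) GaussianInt) - cellM := by
  decide +kernel

/-- (i) `apex − letter = a·x₀`. -/
theorem apex_sub_letter (k : K3) : apexLetter.M - (letterOf k).M = torusAct (aOf k) chainLetter := by
  rw [apexLetter_M, letterOf_M, chainLetter_eq, torusAct_sub, torusAct_smul_one]

theorem phase_mul_star_phase (a : Fin 8 → ℕ) (I : Finset (Fin 8)) : phase a I * star (phase a I) = 1 := by
  unfold phase
  rw [star_prod, ← Finset.prod_mul_distrib]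
  exact Finset.prod_eq_one fun j _ => by rw [mul_comm, star_iU_pow_mul]

/-- (ii) principal minors are torus-invariant. -/
theorem principalMinor_torusAct (a : Fin 8 → ℕ) (M : Matrix (Fin 8) (Fin 8) GaussianInt) (I : Finset (Fin 8)) :
    minor (torusAct a M) I I = minor M I I := by
  rw [minor_torusAct, phase_mul_star_phase, one_mul]

/-- zero-padding: `det (A B) = 0` for `A ∈ M_{(4+d)×4}`, `B ∈ M_{4×(4+d)}`, `d ≥ 1`. -/
theorem det_mul_eq_zero_of_thin {d : ℕ} (hd : 0 < d) (A : Matrix (Fin (4 + d)) (Fin 4) GaussianInt)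
    (B : Matrix (Fin 4) (Fin (4 + d)) GaussianInt) : (A * B).det = 0 := by
  let padA : Matrix (Fin (4 + d)) (Fin (4 + d)) GaussianInt := Matrix.of fun i j => Fin.addCases (fun j' => A i j') (fun _ => 0) j
  let padB : Matrix (Fin (4 + d)) (Fin (4 + d)) GaussianInt := Matrix.of fun i j => Fin.addCases (fun i' => B i' j) (fun _ => 0) i
  have hmul : padA * padB = A * B := by
    refine Matrix.ext fun i j => ?_
    simp only [Matrix.mul_apply, Fin.sum_univ_add, padA, padB, Matrix.of_apply, Fin.addCases_left, Fin.addCases_right, mul_zero,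
      Finset.sum_const_zero, add_zero]
  have hA : padA.det = 0 :=
    Matrix.det_eq_zero_of_column_eq_zero (Fin.natAdd 4 ⟨0, hd⟩) fun i => by
      simp only [padA]; rw [Matrix.of_apply, Fin.addCases_right]
  rw [← hmul, Matrix.det_mul, hA, zero_mul]

/-- (iii) every minor of size `≥ 5` of a Gram `W W*`, `W ∈ M_{8×4}(ℤ[i])`, vanishes. -/
theorem minor_gram_eq_zero (Wf : Matrix (Fin 8) (Fin 4) GaussianInt) (I J : Finset (Fin 8)) (hI : 4 < I.card) :
    minor (Wf * Wf.conjTranspose) I J = 0 := by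
  unfold minor
  by_cases h : (enum8 J).length = (enum8 I).length
  · rw [dif_pos h]
    obtain ⟨d, hd, hk⟩ : ∃ d, 0 < d ∧ (enum8 I).length = 4 + d := ⟨(enum8 I).length - 4, by rw [length_enum8]; omega, by
      rw [length_enum8]; omega⟩
    let e : Fin (4 + d) ≃ Fin (enum8 I).length := finCongr hk.symm
    rw [← Matrix.det_submatrix_equiv_self e, Matrix.submatrix_submatrix,
      Matrix.submatrix_mul _ _ _ (id : Fin 4 → Fin 4) _ Function.bijective_id]
    exact det_mul_eq_zero_of_thin hd _ _
  · rw [dif_neg h]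

/-- the unit CHAIN FRAME `W₀ ∈ M_{8×4}(ℤ)` (`t = 0`), `x₀ = W₀W₀*`. -/
def chainFrame : Matrix (Fin 8) (Fin 4) GaussianInt :=
  !![1, 0, 0, 0;
     -1, 0, 0, 0;
     1, 1, 0, 0;
     -1, -1, 0, 0;
     0, 1, 1, 0;
     0, -1, -1, 0;
     0, 0, 1, 1;
     0, 0, -1, -1]

theorem chainLetter_gram : chainLetter = chainFrame * chainFrame.conjTranspose := by
  decide +kernel

/-- the `163` principal minors of `x₀` of size `≤ 4` are real and `≥ 0`. [kernel enumeration] -/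
theorem chainLetter_smallMinors : ∀ I : Finset (Fin 8), I.card ≤ 4 → (minor chainLetter I I).im = 0 ∧ 0 ≤ (minor chainLetter I I).re := by
  decide +kernel

/-- `x₀ ⪰ 0` in the alphabet's live rule. -/
theorem chainLetter_pmn : PrincipalMinorsNonneg chainLetter := fun I => by
  by_cases hI : I.card ≤ 4
  · exact chainLetter_smallMinors I hI
  · rw [chainLetter_gram, minor_gram_eq_zero chainFrame I I (by omega)]
    simp

/-- **the apex is live above every design letter**: `Live (letterOf k) apexLetter` (`a(k)·x₀ ⪰ 0`). -/
theorem live_letter_apex (k : K3) : nonboxAlphabet.Live (letterOf k) apexLetter := by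
  show PrincipalMinorsNonneg (apexLetter.M - (letterOf k).M)
  rw [apex_sub_letter]
  intro I
  rw [principalMinor_torusAct]
  exact chainLetter_pmn I

theorem toyPres_mN_nonneg (Z : NonboxLetter) : 0 ≤ toyPres.mN Z := by
  show (0 : ℤ) ≤ if Z.M 0 0 = 4 then 33 else 1
  split_ifs <;> decide

/-- **(KI) UP-HALL HOLDS for the toy** (`MonadDesign.HallI` of the cokernel embedding `⊕_P → ⊕_N → 𝓔 → 0`): any non-empty set `U` of `P`-letters has the
apex (multiplicity `33 ≥ 32 ≥ |U|`) in its live neighbourhood. -/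
theorem toyPres_hallUp : (MonadDesign.ofCokernel toyPres).HallI := by
  show ∀ U ∈ toyPres.P.powerset, ∀ W ∈ toyPres.N.powerset, (∀ a ∈ U, ∀ n ∈ toyPres.N, nonboxAlphabet.Live a n → n ∈ W) →
    ∑ a ∈ U, toyPres.mP a ≤ ∑ n ∈ W, toyPres.mN n
  intro U hU W hW hcl
  rcases U.eq_empty_or_nonempty with h0 | ⟨a, ha⟩
  · subst h0
    simpa using Finset.sum_nonneg fun n _ => toyPres_mN_nonneg n
  · have hUP : U ⊆ toyPres.P := Finset.mem_powerset.1 hU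
    have haP : a ∈ Kneg.map letterEmb := by rw [← toyPres_P]; exact hUP ha
    obtain ⟨k, _, rfl⟩ := Finset.mem_map.1 haP
    have hapexN : apexLetter ∈ toyPres.N := by rw [toyPres_N]; exact Finset.mem_cons_self _ _
    have hapexW : apexLetter ∈ W := hcl _ ha apexLetter hapexN (live_letter_apex k)
    calc ∑ a ∈ U, toyPres.mP a = U.card := by simp [toyPres_mP]
      _ ≤ (Kneg.map letterEmb).card := by exact_mod_cast Finset.card_le_card (by rw [← toyPres_P]; exact hUP)
      _ ≤ 33 := by rw [Finset.card_map]; exact_mod_cast (show Kneg.card ≤ 33 by decide +kernel)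
      _ = toyPres.mN apexLetter := mN_apex.symm
      _ ≤ ∑ n ∈ W, toyPres.mN n := Finset.single_le_sum (fun n _ => toyPres_mN_nonneg n) hapexW

/-! ## §7 … and why it is NOT a seed: every `N`-letter is BARE (NO-BARE ∕ (B1♯) `Σ ≠ ∅`, semihom-2 g2 (A))

Two distinct design letters are never comparable in the live rule: `a′·c − a·c` has zero diagonal and a non-zero entry on the chain's super-diagonal,
so a `2×2` principal minor is `−|δ|² < 0`.  Hence no `P`-letter maps to any `N`-letter: all `32` `N`-letters are bare direct summands of the middle
term — the UP design is NO-BARE-dead exactly as every two-copy UP design on line-bundle letters (g2 (A)); the toy is an address ∕ calibration object. -/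

/-- for distinct letters some super-diagonal `2×2` principal minor of the difference is negative. [kernel enumeration, `4096 × 7` minors] -/
theorem letters_incomparable : ∀ k k' : K3, k ≠ k' →
    ∃ j : Fin 7, (minor ((letterOf k').M - (letterOf k).M) {j.castSucc, j.succ} {j.castSucc, j.succ}).re < 0 := by
  decide +kernel

/-- distinct design letters are dead for the live rule (neither maps to the other twisted by a nef class … at the level of the alphabet's `Live`). -/
theorem not_live_letters {k k' : K3} (h : k ≠ k') : ¬ nonboxAlphabet.Live (letterOf k) (letterOf k') := by
  obtain ⟨j, hj⟩ := letters_incomparable k k' h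
  exact not_principalMinorsNonneg_of_neg hj

/-- the apex maps to no letter (`letter − apex = −a·x₀`, corner minor `−1`). -/
theorem not_live_apex_letter (k : K3) : ¬ nonboxAlphabet.Live apexLetter (letterOf k) := by
  refine not_principalMinorsNonneg_of_neg (I := {0}) ?_
  have h : (letterOf k).M - apexLetter.M = -torusAct (aOf k) chainLetter := by rw [← apex_sub_letter, neg_sub]
  have hneg : -torusAct (aOf k) chainLetter = torusAct (aOf k) (-chainLetter) := by
    refine Matrix.ext fun i j => ?_
    simp only [torusAct, Matrix.neg_apply, Matrix.of_apply]
    ring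
  rw [h, hneg, principalMinor_torusAct]
  decide +kernel

/-- **NO-BARE FAILS**: every `N`-letter of the toy is BARE — no `P`-cell is live below it (so `Σ = ` all `32` `N`-letters `≠ ∅`). -/
theorem toy_N_letters_bare : ∀ k ∈ Kpos, ∀ a ∈ toyPres.P, ¬ nonboxAlphabet.Live a (letterOf k) := by
  intro k hk a ha
  rw [toyPres_P] at ha
  obtain ⟨k', hk', rfl⟩ := Finset.mem_map.1 ha
  have hne : k' ≠ k := by
    rintro rfl
    simp only [Kpos, Kneg, Finset.mem_filter, Finset.mem_univ, true_and] at hk hk'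
    omega
  exact not_live_letters hne


/-! ## §8 VARIANT B: a bottom apex un-bares the toy — and why that is no evidence (v1.1)

The toy `toyPres` fails NO-BARE (§7).  VARIANT B = the same 64 letters with the top apex at multiplicity `40` and ONE MORE `P`-cell, the BOTTOM
APEX `⟨(−4)·1, 1⟩` (the line bundle `L_{−4I}`) at multiplicity `8`.  Certified below: **`8·1 − x₀ ≻ 0`** (`eightSub_pd`: all `256` principal
minors real and positive, by the Weinstein–Aronszajn reduction `8⁴·det(8·1 − x₀)[I;I] = 8^{|I|}·det(8·1₄ − G_I)` — Mathlib
`Matrix.charpoly_mul_comm'` evaluated at `8`, `G_I = Σ_{i∈I} wᵢ* wᵢ` — plus a kernel enumeration of `256` reduced `4×4` determinants; no `8×8`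
determinant is expanded); the bottom apex is LIVE BELOW EVERY `N`-cell (`live_bot_letter`, `live_bot_apex`); and `variantB_designSide`: ALL
DESIGN-SIDE SCREENS PASS AT ONCE — cells Hermitian, `XScreen` (A1), `μ = 64`, rank `32 = 40 − 8` (`|μ|∕rank = 2`), `(KI)` UP-Hall, NO-BARE PROPER
(every `N`-cell has the bottom apex live strictly below it); `|N| = |P| = 33` cells, `Σ m_N − Σ m_P = 72 − 40 = 32`.
HONEST SCOPE (the point of the variant): rank `32 ≥ 8 = dim E_i⁸` is the STABLE RANGE, where a fibrewise-injective `⊕_P → ⊕_N` exists for generic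
maps by the Porteous count (`P`-letters → top-apex block `40 × 32`: degeneracy codimension `9 > 8`), as it must — every effective K-class of rank
`≥ dim X` is a vector bundle.  So passing every design-side screen carries NO evidence toward a seed; the open hypotheses are exactly the object-side
ones of the compound door (`hR`, local freeness, `IsISemiregular`).  It also records that NO-BARE verdicts are relative to alphabets WITHOUT bottom apexes. -/

/-! ## §8.1 `8·1 − x₀ ≻ 0` by the Weinstein–Aronszajn reduction to `4 × 4` -/

/-- `8·1 − x₀`. -/
def eightSub : Matrix (Fin 8) (Fin 8) GaussianInt := (8 : GaussianInt) • (1 : Matrix (Fin 8) (Fin 8) GaussianInt) - chainLetter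

/-- the `4×4` Gram of the chain frame on the rows `I`: `G_I = Σ_{i∈I} wᵢ* wᵢ = W₀[I]* W₀[I]`. -/
def gramOn (I : Finset (Fin 8)) : Matrix (Fin 4) (Fin 4) GaussianInt :=
  fun p q => ∑ i ∈ I, star (chainFrame i p) * chainFrame i q

theorem sum_enum8_get (I : Finset (Fin 8)) (g : Fin 8 → GaussianInt) :
    ∑ i : Fin (enum8 I).length, g ((enum8 I).get i) = ∑ j ∈ I, g j := by
  rw [← enum8_toFinset I, List.sum_toFinset _ (enum8_nodup I), enum8_toFinset]
  simp [Fin.sum_univ_fun_getElem]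

/-- **Weinstein–Aronszajn on the `enum8` minors**: `8⁴ · det(8·1 − x₀)[I;I] = 8^{|I|} · det(8·1₄ − G_I)`. -/
theorem minor_eightSub (I : Finset (Fin 8)) :
    (8 : GaussianInt) ^ 4 * minor eightSub I I = (8 : GaussianInt) ^ I.card * (Matrix.scalar (Fin 4) 8 - gramOn I).det := by
  unfold minor
  have h : (enum8 I).length = (enum8 I).length := rfl
  rw [dif_pos h]
  set e : Fin (enum8 I).length → Fin 8 := fun i => (enum8 I).get i with he_def
  have he : Function.Injective e := fun i j hij => (enum8_nodup I).get_inj_iff.mp hij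
  have hcol : (fun j : Fin (enum8 I).length => (enum8 I).get (Fin.cast h.symm j)) = e := by
    funext j
    have hc : Fin.cast h.symm j = j := Fin.ext rfl
    rw [hc]
  rw [hcol]
  set A : Matrix (Fin (enum8 I).length) (Fin 4) GaussianInt := chainFrame.submatrix e id with hA_def
  have hsub : eightSub.submatrix e e = Matrix.scalar (Fin (enum8 I).length) 8 - A * A.conjTranspose := by
    refine Matrix.ext fun i j => ?_
    simp only [eightSub, chainLetter_gram, Matrix.submatrix_apply, Matrix.sub_apply, Matrix.smul_apply, Matrix.one_apply,
      he.eq_iff, Matrix.mul_apply, Matrix.conjTranspose_apply, Matrix.scalar_apply, Matrix.diagonal_apply, hA_def,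
      Matrix.submatrix_apply, id, smul_eq_mul, mul_ite, mul_one, mul_zero]
  have hgram : A.conjTranspose * A = gramOn I := by
    refine Matrix.ext fun p q => ?_
    simp only [Matrix.mul_apply, Matrix.conjTranspose_apply, hA_def, Matrix.submatrix_apply, id, gramOn]
    exact sum_enum8_get I (fun i => star (chainFrame i p) * chainFrame i q)
  have key := congrArg (Polynomial.eval (8 : GaussianInt)) (Matrix.charpoly_mul_comm' A A.conjTranspose)
  simp only [Polynomial.eval_mul, Polynomial.eval_pow, Polynomial.eval_X, Matrix.eval_charpoly, Fintype.card_fin, hgram] at key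
  rw [hsub, ← length_enum8 I]
  exact key

/-- all `256` reduced determinants `det(8·1₄ − G_I)` are real and positive. [kernel enumeration of `4×4` determinants] -/
theorem gramOn_reduced_pos : ∀ I : Finset (Fin 8),
    (Matrix.scalar (Fin 4) (8 : GaussianInt) - gramOn I).det.im = 0 ∧ 0 < (Matrix.scalar (Fin 4) (8 : GaussianInt) - gramOn I).det.re := by
  decide +kernel

theorem intCast_mul_re_im (n : ℤ) (z : GaussianInt) : ((n : GaussianInt) * z).re = n * z.re ∧ ((n : GaussianInt) * z).im = n * z.im := by
  constructor
  · simp [Zsqrtd.re_mul]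
  · simp [Zsqrtd.im_mul]

theorem eight_pow_cast (k : ℕ) : (8 : GaussianInt) ^ k = (((8 : ℤ) ^ k : ℤ) : GaussianInt) := by
  push_cast; rfl

/-- **`8·1 − x₀ ≻ 0`**: every principal minor of `8·1 − x₀` is real and positive. -/
theorem eightSub_pd (I : Finset (Fin 8)) : (minor eightSub I I).im = 0 ∧ 0 < (minor eightSub I I).re := by
  have key := minor_eightSub I
  obtain ⟨him, hre⟩ := gramOn_reduced_pos I
  rw [eight_pow_cast, eight_pow_cast] at key
  have kre := congrArg Zsqrtd.re key
  have kim := congrArg Zsqrtd.im key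
  simp only [(intCast_mul_re_im _ _).1, (intCast_mul_re_im _ _).2, him, mul_zero] at kre kim
  have h4 : (0 : ℤ) < (8 : ℤ) ^ 4 := by norm_num
  have hc : (0 : ℤ) < (8 : ℤ) ^ I.card := pow_pos (by norm_num) _
  refine ⟨?_, ?_⟩
  · rcases mul_eq_zero.mp kim with h0 | h0
    · exact absurd h0 h4.ne'
    · exact h0
  · have hpos : 0 < (8 : ℤ) ^ I.card * (Matrix.scalar (Fin 4) (8 : GaussianInt) - gramOn I).det.re := mul_pos hc hre
    nlinarith

/-- `8·1 − x₀ ⪰ 0` in the alphabet's live rule. -/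
theorem eightSub_pmn : PrincipalMinorsNonneg eightSub := fun I => ⟨(eightSub_pd I).1, (eightSub_pd I).2.le⟩

/-! ## §8.2 The BOTTOM APEX `⟨(−4)·1, 1⟩` and its liveness below every `N`-cell -/

/-- the bottom apex letter `L_{−4I}`: slope numerator `(−4)·1`, rank weight `1`. -/
def botLetter : NonboxLetter := ⟨(-4 : GaussianInt) • (1 : Matrix (Fin 8) (Fin 8) GaussianInt), 1⟩

@[simp] theorem botLetter_rk : botLetter.rk = 1 := rfl
@[simp] theorem botLetter_M : botLetter.M = (-4 : GaussianInt) • (1 : Matrix (Fin 8) (Fin 8) GaussianInt) := rfl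

theorem botLetter_corner : botLetter.M 0 0 = -4 := by
  simp [Matrix.smul_apply]

/-- `(4·1 − a·x₀) − (−4)·1 = a·(8·1 − x₀)`. -/
theorem letter_sub_bot (k : K3) : (letterOf k).M - botLetter.M = torusAct (aOf k) eightSub := by
  rw [letterOf_M, botLetter_M, ← torusAct_smul_one (aOf k) (-4), ← torusAct_sub]
  congr 1
  rw [eightSub, chainLetter_eq]
  refine Matrix.ext fun i j => ?_
  simp only [Matrix.sub_apply, Matrix.smul_apply, Matrix.one_apply, smul_eq_mul]
  split_ifs <;> ring

/-- **the bottom apex is live below every design letter** (`Live botLetter (letterOf k)`, i.e. `a·(8·1 − x₀) ⪰ 0`). -/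
theorem live_bot_letter (k : K3) : nonboxAlphabet.Live botLetter (letterOf k) := by
  show PrincipalMinorsNonneg ((letterOf k).M - botLetter.M)
  rw [letter_sub_bot]
  intro I
  rw [principalMinor_torusAct]
  exact eightSub_pmn I

theorem apex_sub_bot : apexLetter.M - botLetter.M = (8 : GaussianInt) • (1 : Matrix (Fin 8) (Fin 8) GaussianInt) := by
  rw [apexLetter_M, botLetter_M, ← sub_smul]
  norm_num

/-- the bottom apex is live below the top apex (`8·1 ⪰ 0`). -/
theorem live_bot_apex : nonboxAlphabet.Live botLetter apexLetter := by
  show PrincipalMinorsNonneg (apexLetter.M - botLetter.M)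
  rw [apex_sub_bot]
  intro I
  rw [minor_smul_one, if_pos rfl, eight_pow_cast]
  exact ⟨Zsqrtd.im_intCast _, by rw [Zsqrtd.re_intCast]; positivity⟩

/-! ## §8.3 The presentation VARIANT B and its design-side screens -/

theorem bot_not_mem : botLetter ∉ Kneg.map letterEmb := fun h => by
  obtain ⟨k, _, hk⟩ := Finset.mem_map.1 h
  have h3 : (letterEmb k).M 0 0 = 3 := letterOf_corner k
  rw [hk, botLetter_corner] at h3
  exact absurd h3 (by decide)

/-- **VARIANT B (UP reading)** `⊕_P → ⊕_N → 𝓔 → 0` over `nonboxAlphabet`: `N` = the 32 letters with `χ_W = +1` ⊔ apex `L_{4I}` (multiplicity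
`40`); `P` = the 32 letters with `χ_W = −1` ⊔ the BOTTOM apex `L_{−4I}` (multiplicity `8`).  Multiplicities are read off the corner entry. -/
def toyPresB : Presentation nonboxAlphabet where
  N := Finset.cons apexLetter (Kpos.map letterEmb) apex_not_mem
  P := Finset.cons botLetter (Kneg.map letterEmb) bot_not_mem
  mN := fun Z => if Z.M 0 0 = 4 then 40 else 1
  mP := fun Z => if Z.M 0 0 = -4 then 8 else 1

theorem toyPresB_N : toyPresB.N = Finset.cons apexLetter (Kpos.map letterEmb) apex_not_mem := rfl
theorem toyPresB_P : toyPresB.P = Finset.cons botLetter (Kneg.map letterEmb) bot_not_mem := rfl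

theorem mNB_letter (k : K3) : toyPresB.mN (letterOf k) = 1 := by
  show (if (letterOf k).M 0 0 = 4 then (40 : ℤ) else 1) = 1
  rw [letterOf_corner]; decide

theorem mNB_apex : toyPresB.mN apexLetter = 40 := by
  show (if apexLetter.M 0 0 = 4 then (40 : ℤ) else 1) = 40
  rw [apexLetter_corner]; simp

theorem mPB_letter (k : K3) : toyPresB.mP (letterOf k) = 1 := by
  show (if (letterOf k).M 0 0 = -4 then (8 : ℤ) else 1) = 1
  rw [letterOf_corner]; decide

theorem mPB_bot : toyPresB.mP botLetter = 8 := by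
  show (if botLetter.M 0 0 = -4 then (8 : ℤ) else 1) = 8
  rw [botLetter_corner]; simp

/-- the BOTTOM APEX class `ch⟨(−4)·1, 1⟩`. -/
def botCh : XWord → GaussianInt := compoundCh 1 ((-4 : GaussianInt) • (1 : Matrix (Fin 8) (Fin 8) GaussianInt))

/-- class tensor of variant B, word by word: signed toy part `+ 40 ×` apex class `− 8 ×` bottom-apex class. -/
theorem toyPresB_wch_apply (w : XWord) : toyPresB.wch w = toyCh w + 40 * apexCh w - 8 * botCh w := by
  simp only [Presentation.wch, Pi.sub_apply, Finset.sum_apply, Pi.smul_apply]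
  rw [toyPresB_N, toyPresB_P, Finset.sum_cons, Finset.sum_cons, Finset.sum_map, Finset.sum_map, mNB_apex, mPB_bot]
  simp only [letterEmb_apply, mNB_letter, mPB_letter, one_smul, toyCh_split w, zsmul_eq_mul, letterOf_rk, letterOf_M,
    apexLetter_rk, apexLetter_M, botLetter_rk, botLetter_M, PNat.one_coe, apexCh, botCh]
  push_cast
  ring

theorem toyPresB_wch : toyPresB.wch = (toyCh + fun w => 40 * apexCh w) + fun w => (-8) * botCh w :=
  funext fun w => by simp only [toyPresB_wch_apply, Pi.add_apply]; ring

/-- **(A1) ON THE COMPOUND FRAME** for variant B. -/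
theorem toyPresB_clean : XScreen toyPresB.wch := by
  rw [toyPresB_wch]
  exact xscreen_add (xscreen_add toy_xscreen (xscreen_constMul (xscreen_apex 1 4) 40)) (xscreen_constMul (xscreen_apex 1 (-4)) (-8))

/-- **WEIL MINOR `μ = 64`** (apex classes vanish off the diagonal). -/
theorem toyPresB_mu : toyPresB.wch eXWord = 64 := by
  rw [toyPresB_wch_apply, toy_mu, apexCh, botCh, eXWord, compoundCh_apply, compoundCh_apply, minor_smul_one, minor_smul_one,
    if_neg (show I0 ≠ J0 by decide), if_neg (show I0 ≠ J0 by decide)]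
  simp

theorem toyPresB_mubar : toyPresB.wch ebarXWord = 64 := by
  rw [toyPresB_wch_apply, toy_mubar, apexCh, botCh, ebarXWord, compoundCh_apply, compoundCh_apply, minor_smul_one, minor_smul_one,
    if_neg (show J0 ≠ I0 by decide), if_neg (show J0 ≠ I0 by decide)]
  simp

/-- **rank `32 = 40 − 8`** (the `(∅;∅)` coefficient). -/
theorem toyPresB_rank : toyPresB.wch oneXWord = 32 := by
  rw [toyPresB_wch_apply, toy_rank]
  simp only [apexCh, botCh, oneXWord, compoundCh_apply, minor_smul_one, Finset.card_empty, pow_zero, if_true]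
  norm_num

theorem botLetter_isHerm : botLetter.IsHerm := by
  decide +kernel

/-- **ALL CELLS HERMITIAN** for variant B. -/
theorem toyPresB_allHerm : (∀ Z ∈ toyPresB.N, NonboxLetter.IsHerm Z) ∧ ∀ Z ∈ toyPresB.P, NonboxLetter.IsHerm Z := by
  refine ⟨toyPres_allHerm.1, fun Z hZ => ?_⟩
  rw [toyPresB_P, Finset.mem_cons] at hZ
  rcases hZ with h | h
  · subst h; exact botLetter_isHerm
  · exact toyPres_allHerm.2 Z (by rw [toyPres_P]; exact h)

/-- counts: `|N| = 33` cells (`32` letters + apex), `|P| = 33` (`32` letters + bottom apex); `Σ m_N − Σ m_P = 72 − 40 = 32 = rank`. -/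
theorem toyPresB_counts : toyPresB.N.card = 33 ∧ toyPresB.P.card = 33 ∧ toyPresB.count = 32 := by
  have hp : Kpos.card = 32 := by decide +kernel
  have hn : Kneg.card = 32 := by decide +kernel
  refine ⟨by rw [toyPresB_N, Finset.card_cons, Finset.card_map, hp], by rw [toyPresB_P, Finset.card_cons, Finset.card_map, hn], ?_⟩
  rw [Presentation.count, toyPresB_N, toyPresB_P, Finset.sum_cons, Finset.sum_cons, Finset.sum_map, Finset.sum_map, mNB_apex, mPB_bot]
  simp only [letterEmb_apply, mNB_letter, mPB_letter, Finset.sum_const, hp, hn]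
  decide

theorem toyPresB_mN_nonneg (Z : NonboxLetter) : 0 ≤ toyPresB.mN Z := by
  show (0 : ℤ) ≤ if Z.M 0 0 = 4 then 40 else 1
  split_ifs <;> decide

theorem toyPresB_mP_nonneg (Z : NonboxLetter) : 0 ≤ toyPresB.mP Z := by
  show (0 : ℤ) ≤ if Z.M 0 0 = -4 then 8 else 1
  split_ifs <;> decide

theorem toyPresB_sum_mP : ∑ a ∈ toyPresB.P, toyPresB.mP a = 40 := by
  have hn : Kneg.card = 32 := by decide +kernel
  rw [toyPresB_P, Finset.sum_cons, Finset.sum_map, mPB_bot]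
  simp only [letterEmb_apply, mPB_letter, Finset.sum_const, hn]
  decide

/-- every `P`-cell is live below the top apex. -/
theorem live_P_apex {a : NonboxLetter} (ha : a ∈ toyPresB.P) : nonboxAlphabet.Live a apexLetter := by
  rw [toyPresB_P, Finset.mem_cons] at ha
  rcases ha with h | h
  · subst h; exact live_bot_apex
  · obtain ⟨k, _, rfl⟩ := Finset.mem_map.1 h
    exact live_letter_apex k

/-- **(KI) UP-HALL HOLDS for variant B**: any non-empty `U ⊆ P` has the top apex (multiplicity `40 = Σ_P m_P`) in its live neighbourhood. -/
theorem toyPresB_hallUp : (MonadDesign.ofCokernel toyPresB).HallI := by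
  show ∀ U ∈ toyPresB.P.powerset, ∀ W ∈ toyPresB.N.powerset, (∀ a ∈ U, ∀ n ∈ toyPresB.N, nonboxAlphabet.Live a n → n ∈ W) →
    ∑ a ∈ U, toyPresB.mP a ≤ ∑ n ∈ W, toyPresB.mN n
  intro U hU W hW hcl
  rcases U.eq_empty_or_nonempty with h0 | ⟨a, ha⟩
  · subst h0
    simpa using Finset.sum_nonneg fun n _ => toyPresB_mN_nonneg n
  · have hUP : U ⊆ toyPresB.P := Finset.mem_powerset.1 hU
    have hapexN : apexLetter ∈ toyPresB.N := by rw [toyPresB_N]; exact Finset.mem_cons_self _ _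
    have hapexW : apexLetter ∈ W := hcl _ ha apexLetter hapexN (live_P_apex (hUP ha))
    calc ∑ a ∈ U, toyPresB.mP a ≤ ∑ a ∈ toyPresB.P, toyPresB.mP a :=
          Finset.sum_le_sum_of_subset_of_nonneg hUP fun a _ _ => toyPresB_mP_nonneg a
      _ = 40 := toyPresB_sum_mP
      _ = toyPresB.mN apexLetter := mNB_apex.symm
      _ ≤ ∑ n ∈ W, toyPresB.mN n := Finset.single_le_sum (fun n _ => toyPresB_mN_nonneg n) hapexW

/-- **NO-BARE PROPER HOLDS for variant B**: every `N`-cell has a `P`-cell (the bottom apex) live strictly below it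
(semihom-2 g2 NB1: `y ∈ N` is bare iff no `x ∈ P` with `Q_x − Q_y ⪰ 0`, `Q_x ≠ Q_y`). -/
theorem toyPresB_noBare : ∀ n ∈ toyPresB.N, ∃ a ∈ toyPresB.P, nonboxAlphabet.Live a n ∧ a.M ≠ n.M := by
  intro n hn
  have hbot : botLetter ∈ toyPresB.P := by rw [toyPresB_P]; exact Finset.mem_cons_self _ _
  rw [toyPresB_N, Finset.mem_cons] at hn
  refine ⟨botLetter, hbot, ?_, fun h => ?_⟩
  · rcases hn with h | h
    · subst h; exact live_bot_apex
    · obtain ⟨k, _, rfl⟩ := Finset.mem_map.1 h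
      exact live_bot_letter k
  · have hc := congrFun (congrFun h 0) 0
    rw [botLetter_corner] at hc
    rcases hn with h' | h'
    · subst h'
      rw [apexLetter_corner] at hc
      exact absurd hc (by decide)
    · obtain ⟨k, _, rfl⟩ := Finset.mem_map.1 h'
      have h3 : (letterEmb k).M 0 0 = 3 := letterOf_corner k
      rw [h3] at hc
      exact absurd hc (by decide)

/-- **VARIANT B PASSES EVERY DESIGN-SIDE SCREEN AT ONCE** — all cells Hermitian (`AllHermPres`-shape), `XScreen` (A1), `μ = 64 ≠ 0`, rank
`32`, `(KI)` UP-Hall, NO-BARE proper.  (Object side — realisation, local freeness, semiregularity — untouched; rank `32 ≥ dim X = 8` is the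
stable range, so this is a calibration object, not evidence.) -/
theorem variantB_designSide :
    ((∀ Z ∈ toyPresB.N, NonboxLetter.IsHerm Z) ∧ ∀ Z ∈ toyPresB.P, NonboxLetter.IsHerm Z) ∧ XScreen toyPresB.wch ∧
      toyPresB.wch eXWord = 64 ∧ toyPresB.wch oneXWord = 32 ∧ (MonadDesign.ofCokernel toyPresB).HallI ∧
      ∀ n ∈ toyPresB.N, ∃ a ∈ toyPresB.P, nonboxAlphabet.Live a n ∧ a.M ≠ n.M :=
  ⟨toyPresB_allHerm, toyPresB_clean, toyPresB_mu, toyPresB_rank, toyPresB_hallUp, toyPresB_noBare⟩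

/-- the same on the THREE-TERM reading `MonadDesign.ofCokernel toyPresB`: `AllHermMonad`-shape, `CleanX`, `muX = 64`, `rankX = 32`, `muBarX = 64`. -/
theorem variantB_monad_jsonSide :
    ((∀ Z ∈ (MonadDesign.ofCokernel toyPresB).A, NonboxLetter.IsHerm Z) ∧ (∀ Z ∈ (MonadDesign.ofCokernel toyPresB).N, NonboxLetter.IsHerm Z) ∧
        ∀ Z ∈ (MonadDesign.ofCokernel toyPresB).C, NonboxLetter.IsHerm Z) ∧
      (MonadDesign.ofCokernel toyPresB).CleanX ∧ (MonadDesign.ofCokernel toyPresB).muX = 64 ∧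
      (MonadDesign.ofCokernel toyPresB).rankX = 32 ∧ (MonadDesign.ofCokernel toyPresB).muBarX = 64 := by
  refine ⟨⟨toyPresB_allHerm.2, toyPresB_allHerm.1, fun Z hZ => ?_⟩, ?_, ?_, ?_, ?_⟩
  · exact absurd hZ (by simp [MonadDesign.ofCokernel])
  · show XScreen (MonadDesign.ofCokernel toyPresB).wch
    rw [MonadDesign.wch_ofCokernel]; exact toyPresB_clean
  · show (MonadDesign.ofCokernel toyPresB).wch eXWord = 64
    rw [MonadDesign.wch_ofCokernel, toyPresB_mu]
  · show (MonadDesign.ofCokernel toyPresB).wch oneXWord = 32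
    rw [MonadDesign.wch_ofCokernel, toyPresB_rank]
  · show (MonadDesign.ofCokernel toyPresB).wch ebarXWord = 64
    rw [MonadDesign.wch_ofCokernel, toyPresB_mubar]

end Summit.HodgeConjecture.HodgeConjecture.Cruxes.BlochSeedDiscOne.CompoundTorusDesign
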